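import Literature.NumberTheory.LFunctions.MauduitRivatTypeIIOpening
import HarnessLib

/-!
# Mauduit–Rivat's type-II estimate for unitary matrices, step 2: passing to the middle digits ((56)–(63) of Mauduit–Rivat 2015, Lemma 5.3 of Müllner 2017; proved)

Everything in this file is PROVED (plus plain definitions). It continues
`MauduitRivatTypeIIOpening.lean`: after two van der Corput steps the opened type-II sum is
controlled by the correlation sums `S₂'(s)` (`corrS2`) of the truncated sequence
`F_{μ₂} = U ∘ f_{μ₂}`, whose summands are `e(ϑ s k^{μ₁} r) tr U(φ(x₁)φ(x₂)⁻¹φ(x₃)φ(x₄)⁻¹)`,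
`φ = f_{μ₁}⁻¹ f_{μ₂}` (`trace_fourWord_eq`). Following C. Mauduit, J. Rivat, J. Eur. Math. Soc. 17
(2015), pp. 2612–2613 ((59)–(63)) and C. Müllner, Duke Math. J. 166 (2017), §5.4.2, the function
`φ` is replaced by the function `g(u) = φ(k^{μ₀}u)` (`midFun`) of the MIDDLE DIGITS
`u = r_{μ₀,μ₂}(x)` (`midDigit`), at the cost of the exceptional pairs of Lemma 9 / Lemma 5.3:

* `midDigit_add_mul_pow`, `midFun_mod` — "`r_{μ₀,μ₂}(mn + q^{μ₁}sn) = r_{μ₂−μ₀}(u₀ + q^{μ₁−μ₀}sn)`"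
  and the `k^{μ₂−μ₀}`-periodicity of `g` (MR p. 2613);
* `corrS3` — the sum `S₃(s) = ∑_r ∑_n ∑_m e(ϑ s k^{μ₁} r) tr U(g(u₁+s̃(n+r)) g(u₀+s̃n)⁻¹ g(u₀) g(u₁)⁻¹)`,
  `u₀ = r_{μ₀,μ₂}(mn)`, `u₁ = r_{μ₀,μ₂}(mn+mr)`, `s̃ = s k^{μ₁−μ₀}` (MR (63), matrix order as in
  Müllner's `S₃`);
* `trace_word_eq_of_not_mem` — pointwise: off the four exceptional events the summands of `S₂'(s)`
  and `S₃(s)` agree (`midQuot_eq_midFun_of_not_mem`);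
* `norm_corrS2_sub_corrS3_le` — **(63) with an explicit error**:
  `|S₂'(s) − S₃(s)| ≤ 2d ∑_{1≤r<R} (E₃ + E₄(r) + E₂(s) + E₁(r,s))`, the `Eᵢ` being the numbers of
  pairs in (shifted) boxes whose product has its middle digits in the carry-violation set
  `midViolations` — exactly the quantities bounded by `card_box_midDigit_mem_le` (Lemma 9,
  counting form) and `card_midViolations_le`.

## References
* C. Mauduit, J. Rivat, J. Eur. Math. Soc. 17 (2015): (56)–(63), Lemma 9 (pp. 2603–2605,
  2612–2613). [MauduitRivat2015]
* C. Müllner, Duke Math. J. 166 (2017) = arXiv:1602.03042: Lemma 5.3 and §5.4.2 (pp. 26–28).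
  [Mullner2017]
-/

noncomputable section

open Finset Complex Matrix
open scoped FourierTransform InnerProductSpace ComplexConjugate Matrix.Norms.Frobenius

namespace Literature.NumberTheory.LFunctions.MauduitRivat

variable {d : Type*} [Fintype d] {G : Type*} [Group G]

/-! ## Arithmetic of the middle digits -/

/-- `r_{μ₀,μ₂}(x) = ⌊x/k^{μ₀}⌋ mod k^{μ₂−μ₀}` (`μ₀ ≤ μ₂`). [cite: MauduitRivat2015, §3] -/
theorem midDigit_eq_div_mod {k μ₀ μ₂ : ℕ} (hμ : μ₀ ≤ μ₂) (x : ℕ) :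
    midDigit k μ₀ μ₂ x = x / k ^ μ₀ % k ^ (μ₂ - μ₀) := by
  rw [midDigit_apply, ← Nat.mod_mul_right_div_self, ← pow_add, Nat.add_sub_cancel' hμ]

/-- **Adding a multiple of `k^{μ₀}` shifts the middle digits**:
`r_{μ₀,μ₂}(x + t k^{μ₀}) = (r_{μ₀,μ₂}(x) + t) mod k^{μ₂−μ₀}` (`k ≥ 1`, `μ₀ ≤ μ₂`). This is MR's
"`r_{μ₀,μ₂}(mn + q^{μ₁}sn) = r_{μ₂−μ₀}(u₀ + q^{μ₁−μ₀}sn)`". [cite: MauduitRivat2015, p. 2613] -/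
theorem midDigit_add_mul_pow {k : ℕ} (hk : 0 < k) {μ₀ μ₂ : ℕ} (hμ : μ₀ ≤ μ₂) (x t : ℕ) :
    midDigit k μ₀ μ₂ (x + t * k ^ μ₀) = (midDigit k μ₀ μ₂ x + t) % k ^ (μ₂ - μ₀) := by
  rw [midDigit_eq_div_mod hμ, midDigit_eq_div_mod hμ, Nat.add_mul_div_right _ _ (by positivity),
    Nat.mod_add_mod]

/-- `g` is `k^{μ₂−μ₀}`-periodic: `g(u + t k^{μ₂−μ₀}) = g(u)` (`μ₀ ≤ μ₁ ≤ μ₂`). [cite: MauduitRivat2015, (62)] -/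
theorem midFun_add_mul (k : ℕ) {μ₀ μ₁ μ₂ : ℕ} (h01 : μ₀ ≤ μ₁) (h12 : μ₁ ≤ μ₂) (f : ℕ → G) (u t : ℕ) :
    midFun k μ₀ μ₁ μ₂ f (u + t * k ^ (μ₂ - μ₀)) = midFun k μ₀ μ₁ μ₂ f u := by
  rw [midFun_apply, midFun_apply, midQuot_apply, midQuot_apply]
  have h02 : μ₀ ≤ μ₂ := h01.trans h12
  have e : (u + t * k ^ (μ₂ - μ₀)) * k ^ μ₀ = u * k ^ μ₀ + t * k ^ μ₂ := by
    rw [add_mul, mul_assoc, ← pow_add, Nat.sub_add_cancel h02]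
  have e1 : (u + t * k ^ (μ₂ - μ₀)) * k ^ μ₀ = u * k ^ μ₀ + (t * k ^ (μ₂ - μ₁)) * k ^ μ₁ := by
    rw [e, mul_assoc, ← pow_add, Nat.sub_add_cancel h12]
  rw [show trunc k μ₂ f ((u + t * k ^ (μ₂ - μ₀)) * k ^ μ₀) = trunc k μ₂ f (u * k ^ μ₀) by
    rw [e, trunc_add_mul_pow]]
  rw [show trunc k μ₁ f ((u + t * k ^ (μ₂ - μ₀)) * k ^ μ₀) = trunc k μ₁ f (u * k ^ μ₀) by
    rw [e1, trunc_add_mul_pow]]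

/-- `g(u mod k^{μ₂−μ₀}) = g(u)`. [cite: MauduitRivat2015, (62)] -/
theorem midFun_mod (k : ℕ) {μ₀ μ₁ μ₂ : ℕ} (h01 : μ₀ ≤ μ₁) (h12 : μ₁ ≤ μ₂) (f : ℕ → G) (u : ℕ) :
    midFun k μ₀ μ₁ μ₂ f (u % k ^ (μ₂ - μ₀)) = midFun k μ₀ μ₁ μ₂ f u := by
  conv_rhs => rw [← Nat.mod_add_div u (k ^ (μ₂ - μ₀)), mul_comm, midFun_add_mul k h01 h12]

/-! ## The sum `S₃(s)` -/

/-- **MR's `S₃` for unitary-matrix weights** (matrix order as in Müllner): with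
`u₀ = r_{μ₀,μ₂}(mn)`, `u₁ = r_{μ₀,μ₂}(mn+mr)`, `s̃ = s k^{μ₁−μ₀}`,
`S₃(s) = ∑_{1≤r<R} ∑_{N₀≤n<N₁} ∑_{m, m+sk^{μ₁}<M₁} e(ϑ s k^{μ₁} r) tr U(g(u₁+s̃(n+r)) g(u₀+s̃n)⁻¹ g(u₀) g(u₁)⁻¹)`.
[cite: MauduitRivat2015, (63)] [cite: Mullner2017, §5.4.2 (S₃)] -/
def corrS3 [DecidableEq d] (U : G →* unitaryGroup d ℂ) (f : ℕ → G) (k μ₀ μ₁ μ₂ : ℕ) (ϑ : ℝ)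
    (M₀ M₁ N₀ N₁ R s : ℕ) : ℂ :=
  ∑ r ∈ Ico 1 R, ∑ n ∈ Ico N₀ N₁, ∑ m ∈ (Ico M₀ M₁).filter (fun m => m + s * k ^ μ₁ < M₁),
    (𝐞 (ϑ * (s * ((k ^ μ₁ : ℕ) : ℝ)) * r) : ℂ) *
      trace (U (midFun k μ₀ μ₁ μ₂ f (midDigit k μ₀ μ₂ (m * n + m * r) + s * k ^ (μ₁ - μ₀) * (n + r)) *
        (midFun k μ₀ μ₁ μ₂ f (midDigit k μ₀ μ₂ (m * n) + s * k ^ (μ₁ - μ₀) * n))⁻¹ *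
        midFun k μ₀ μ₁ μ₂ f (midDigit k μ₀ μ₂ (m * n)) *
        (midFun k μ₀ μ₁ μ₂ f (midDigit k μ₀ μ₂ (m * n + m * r)))⁻¹) : Matrix d d ℂ)

/-! ## Pointwise replacement off the exceptional events -/

/-- **The four-fold word in terms of `g`, off the carry violations of Lemma 9.** Let
`μ₀ ≤ μ₁ ≤ μ₂`, `k ≥ 1`, `x₁ = (m+sk^{μ₁})(n+r)`, `x₂ = (m+sk^{μ₁})n`, `x₃ = mn`, `x₄ = m(n+r)`. If
none of `r_{μ₀,μ₂}(xᵢ)` is in `midViolations`, then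
`φ(x₁)φ(x₂)⁻¹φ(x₃)φ(x₄)⁻¹ = g(u₁+s̃(n+r)) g(u₀+s̃n)⁻¹ g(u₀) g(u₁)⁻¹`.
[cite: MauduitRivat2015, (59)–(63)] [cite: Mullner2017, Lemma 5.3] -/
theorem word_eq_of_not_mem {k : ℕ} (hk : 0 < k) {μ₀ μ₁ μ₂ : ℕ} (h01 : μ₀ ≤ μ₁) (h12 : μ₁ ≤ μ₂)
    (f : ℕ → G) (m n r s : ℕ)
    (h1 : midDigit k μ₀ μ₂ ((m + s * k ^ μ₁) * (n + r)) ∉ midViolations k μ₀ μ₁ μ₂ f)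
    (h2 : midDigit k μ₀ μ₂ ((m + s * k ^ μ₁) * n) ∉ midViolations k μ₀ μ₁ μ₂ f)
    (h3 : midDigit k μ₀ μ₂ (m * n) ∉ midViolations k μ₀ μ₁ μ₂ f)
    (h4 : midDigit k μ₀ μ₂ (m * (n + r)) ∉ midViolations k μ₀ μ₁ μ₂ f) :
    midQuot k μ₁ μ₂ f ((m + s * k ^ μ₁) * (n + r)) * (midQuot k μ₁ μ₂ f ((m + s * k ^ μ₁) * n))⁻¹ *
        midQuot k μ₁ μ₂ f (m * n) * (midQuot k μ₁ μ₂ f (m * (n + r)))⁻¹ =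
      midFun k μ₀ μ₁ μ₂ f (midDigit k μ₀ μ₂ (m * n + m * r) + s * k ^ (μ₁ - μ₀) * (n + r)) *
        (midFun k μ₀ μ₁ μ₂ f (midDigit k μ₀ μ₂ (m * n) + s * k ^ (μ₁ - μ₀) * n))⁻¹ *
        midFun k μ₀ μ₁ μ₂ f (midDigit k μ₀ μ₂ (m * n)) *
        (midFun k μ₀ μ₁ μ₂ f (midDigit k μ₀ μ₂ (m * n + m * r)))⁻¹ := by
  have h02 : μ₀ ≤ μ₂ := h01.trans h12
  rw [midQuot_eq_midFun_of_not_mem hk h01 h12 f h1, midQuot_eq_midFun_of_not_mem hk h01 h12 f h2,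
    midQuot_eq_midFun_of_not_mem hk h01 h12 f h3, midQuot_eq_midFun_of_not_mem hk h01 h12 f h4]
  -- the two shifted digits
  have hx2 : (m + s * k ^ μ₁) * n = m * n + (s * k ^ (μ₁ - μ₀) * n) * k ^ μ₀ := by
    have : k ^ μ₁ = k ^ (μ₁ - μ₀) * k ^ μ₀ := by rw [← pow_add, Nat.sub_add_cancel h01]
    rw [this]; ring
  have hx1 : (m + s * k ^ μ₁) * (n + r) = m * (n + r) + (s * k ^ (μ₁ - μ₀) * (n + r)) * k ^ μ₀ := by
    have : k ^ μ₁ = k ^ (μ₁ - μ₀) * k ^ μ₀ := by rw [← pow_add, Nat.sub_add_cancel h01]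
    rw [this]; ring
  rw [hx1, hx2, midDigit_add_mul_pow hk h02, midDigit_add_mul_pow hk h02, midFun_mod k h01 h12,
    midFun_mod k h01 h12, show m * (n + r) = m * n + m * r by ring]

/-! ## The error count -/

section Count

variable [DecidableEq d]

/-- `|tr ↑(U g)| ≤ d` for unitary values. [folklore] -/
theorem norm_trace_coe_unitary_le (V : unitaryGroup d ℂ) :
    ‖trace (V : Matrix d d ℂ)‖ ≤ Fintype.card d := by
  refine (norm_trace_le _).trans ?_
  rw [norm_coe_unitary, ← pow_two, Real.sq_sqrt (Nat.cast_nonneg _)]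

/-- One summand of `S₂'(s) − S₃(s)` is at most `2d` in absolute value. [folklore] -/
theorem norm_phase_mul_trace_sub_le (x : ℝ) (V W : unitaryGroup d ℂ) :
    ‖(𝐞 x : ℂ) * trace (V : Matrix d d ℂ) - (𝐞 x : ℂ) * trace (W : Matrix d d ℂ)‖ ≤ 2 * Fintype.card d := by
  rw [← mul_sub, norm_mul, norm_fourierChar, one_mul]
  refine (norm_sub_le _ _).trans ?_
  have h1 := norm_trace_coe_unitary_le V
  have h2 := norm_trace_coe_unitary_le W
  linarith

/-- The exceptional pairs for one of the four events, as a filter of the `(n, m)` double range.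
[cite: MauduitRivat2015, Lemma 9 (the sets E(a,b,c))] -/
def excSet (P : ℕ → ℕ → Prop) [DecidablePred fun p : ℕ × ℕ => P p.1 p.2] (M₀ M₁ N₀ N₁ L : ℕ) :
    Finset (ℕ × ℕ) :=
  ((Ico N₀ N₁) ×ˢ ((Ico M₀ M₁).filter (fun m => m + L < M₁))).filter fun p => P p.1 p.2

/-- **MR (63) with an explicit error, for unitary-matrix weights.** For `μ₀ ≤ μ₁ ≤ μ₂`, `k ≥ 1`:
`|S₂'(s) − S₃(s)| ≤ 2d · ∑_{1≤r<R} #{(n,m) : one of r(x₁), r(x₂), r(x₃), r(x₄) ∈ midViolations}`,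
where `S₂'` is `corrS2` of `F_{μ₂} = U ∘ f_{μ₂}` (whose summands are `tr U(φx₁ φx₂⁻¹ φx₃ φx₄⁻¹)`
by `trace_fourWord_eq`). [cite: MauduitRivat2015, (63)] [cite: Mullner2017, Lemma 5.3, §5.4.2] -/
theorem norm_corrS2_sub_corrS3_le (U : G →* unitaryGroup d ℂ) (f : ℕ → G) {k : ℕ} (hk : 0 < k)
    {μ₀ μ₁ μ₂ : ℕ} (h01 : μ₀ ≤ μ₁) (h12 : μ₁ ≤ μ₂) (ϑ : ℝ) (M₀ M₁ N₀ N₁ R s : ℕ) :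
    ‖corrS2 ϑ (umat U (trunc k μ₂ f)) M₀ M₁ N₀ N₁ R (k ^ μ₁) s -
        corrS3 U f k μ₀ μ₁ μ₂ ϑ M₀ M₁ N₀ N₁ R s‖ ≤
      2 * Fintype.card d * ∑ r ∈ Ico 1 R,
        ((((Ico N₀ N₁) ×ˢ ((Ico M₀ M₁).filter (fun m => m + s * k ^ μ₁ < M₁))).filter fun p : ℕ × ℕ =>
            midDigit k μ₀ μ₂ ((p.2 + s * k ^ μ₁) * (p.1 + r)) ∈ midViolations k μ₀ μ₁ μ₂ f ∨
            midDigit k μ₀ μ₂ ((p.2 + s * k ^ μ₁) * p.1) ∈ midViolations k μ₀ μ₁ μ₂ f ∨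
            midDigit k μ₀ μ₂ (p.2 * p.1) ∈ midViolations k μ₀ μ₁ μ₂ f ∨
            midDigit k μ₀ μ₂ (p.2 * (p.1 + r)) ∈ midViolations k μ₀ μ₁ μ₂ f).card : ℝ) := by
  classical
  set Bad := midViolations k μ₀ μ₁ μ₂ f with hBad
  -- termwise differences
  set D : ℕ → ℕ → ℕ → ℂ := fun r n m =>
    (𝐞 (ϑ * (s * ((k ^ μ₁ : ℕ) : ℝ)) * r) : ℂ) *
        trace (umat U (trunc k μ₂ f) ((m + s * k ^ μ₁) * (n + r)) * (umat U (trunc k μ₂ f) ((m + s * k ^ μ₁) * n))ᴴ *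
          umat U (trunc k μ₂ f) (m * n) * (umat U (trunc k μ₂ f) (m * (n + r)))ᴴ) -
      (𝐞 (ϑ * (s * ((k ^ μ₁ : ℕ) : ℝ)) * r) : ℂ) *
        trace (U (midFun k μ₀ μ₁ μ₂ f (midDigit k μ₀ μ₂ (m * n + m * r) + s * k ^ (μ₁ - μ₀) * (n + r)) *
          (midFun k μ₀ μ₁ μ₂ f (midDigit k μ₀ μ₂ (m * n) + s * k ^ (μ₁ - μ₀) * n))⁻¹ *
          midFun k μ₀ μ₁ μ₂ f (midDigit k μ₀ μ₂ (m * n)) *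
          (midFun k μ₀ μ₁ μ₂ f (midDigit k μ₀ μ₂ (m * n + m * r)))⁻¹) : Matrix d d ℂ) with hD
  have hdiff : corrS2 ϑ (umat U (trunc k μ₂ f)) M₀ M₁ N₀ N₁ R (k ^ μ₁) s -
      corrS3 U f k μ₀ μ₁ μ₂ ϑ M₀ M₁ N₀ N₁ R s =
      ∑ r ∈ Ico 1 R, ∑ n ∈ Ico N₀ N₁, ∑ m ∈ (Ico M₀ M₁).filter (fun m => m + s * k ^ μ₁ < M₁), D r n m := by
    rw [corrS2, corrS3, ← sum_sub_distrib]
    refine sum_congr rfl fun r _ => ?_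
    rw [← sum_sub_distrib]
    refine sum_congr rfl fun n _ => ?_
    rw [← sum_sub_distrib]
  -- each term is `≤ 2d`, and vanishes off the exceptional events
  have hbound : ∀ r n m, ‖D r n m‖ ≤ 2 * Fintype.card d := by
    intro r n m
    rw [hD]; dsimp only
    rw [trace_fourWord_eq]
    exact norm_phase_mul_trace_sub_le _ _ _
  have hzero : ∀ r n m,
      ¬ (midDigit k μ₀ μ₂ ((m + s * k ^ μ₁) * (n + r)) ∈ Bad ∨ midDigit k μ₀ μ₂ ((m + s * k ^ μ₁) * n) ∈ Bad ∨
          midDigit k μ₀ μ₂ (m * n) ∈ Bad ∨ midDigit k μ₀ μ₂ (m * (n + r)) ∈ Bad) → D r n m = 0 := by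
    intro r n m h
    simp only [not_or] at h
    rw [hD]; dsimp only
    rw [trace_fourWord_eq, word_eq_of_not_mem hk h01 h12 f m n r s h.1 h.2.1 h.2.2.1 h.2.2.2, sub_self]
  rw [hdiff, mul_sum]
  refine (norm_sum_le _ _).trans (sum_le_sum fun r _ => ?_)
  -- the `(n, m)` double sum for fixed `r`
  set S := (Ico N₀ N₁) ×ˢ ((Ico M₀ M₁).filter (fun m => m + s * k ^ μ₁ < M₁)) with hS
  set P : ℕ × ℕ → Prop := fun p =>
    midDigit k μ₀ μ₂ ((p.2 + s * k ^ μ₁) * (p.1 + r)) ∈ Bad ∨ midDigit k μ₀ μ₂ ((p.2 + s * k ^ μ₁) * p.1) ∈ Bad ∨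
      midDigit k μ₀ μ₂ (p.2 * p.1) ∈ Bad ∨ midDigit k μ₀ μ₂ (p.2 * (p.1 + r)) ∈ Bad with hP
  calc ‖∑ n ∈ Ico N₀ N₁, ∑ m ∈ (Ico M₀ M₁).filter (fun m => m + s * k ^ μ₁ < M₁), D r n m‖
      ≤ ∑ n ∈ Ico N₀ N₁, ∑ m ∈ (Ico M₀ M₁).filter (fun m => m + s * k ^ μ₁ < M₁), ‖D r n m‖ :=
        (norm_sum_le _ _).trans (sum_le_sum fun n _ => norm_sum_le _ _)
    _ = ∑ p ∈ S, ‖D r p.1 p.2‖ := (sum_product' _ _ fun n m => ‖D r n m‖).symm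
    _ = ∑ p ∈ S.filter P, ‖D r p.1 p.2‖ := by
        rw [sum_filter]
        refine sum_congr rfl fun p _ => ?_
        split_ifs with h
        · rfl
        · rw [hzero r p.1 p.2 h, norm_zero]
    _ ≤ ∑ _p ∈ S.filter P, (2 * Fintype.card d : ℝ) := sum_le_sum fun p _ => hbound r p.1 p.2
    _ = 2 * Fintype.card d * ((S.filter P).card : ℝ) := by rw [sum_const, nsmul_eq_mul, mul_comm]

/-- The exceptional set of the union of four events is covered by the four single-event sets
(for the subsequent counting by `card_box_midDigit_mem_le`, after the changes of variables
`m' = m + sk^{μ₁}`, `n' = n + r`). [folklore] -/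
theorem card_filter_or_four_le {α : Type*} (S : Finset α) (P₁ P₂ P₃ P₄ : α → Prop)
    [DecidablePred P₁] [DecidablePred P₂] [DecidablePred P₃] [DecidablePred P₄] :
    (S.filter fun a => P₁ a ∨ P₂ a ∨ P₃ a ∨ P₄ a).card ≤
      (S.filter P₁).card + (S.filter P₂).card + (S.filter P₃).card + (S.filter P₄).card := by
  classical
  have h34 := card_union_le (S.filter P₃) (S.filter P₄)
  have h2 := card_union_le (S.filter P₂) (S.filter P₃ ∪ S.filter P₄)
  have h1 := card_union_le (S.filter P₁) (S.filter P₂ ∪ (S.filter P₃ ∪ S.filter P₄))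
  have heq : (S.filter fun a => P₁ a ∨ P₂ a ∨ P₃ a ∨ P₄ a) =
      S.filter P₁ ∪ (S.filter P₂ ∪ (S.filter P₃ ∪ S.filter P₄)) := by
    ext a; simp [mem_filter, mem_union, and_or_left]
  rw [heq]
  omega

/-- **Change of variables for the counting**: the pairs `(n, m)` in
`[N₀,N₁) × {m ∈ [M₀,M₁) : m + L < M₁}` with `r_{μ₀,μ₂}((m+L)(n+r)) ∈ B` inject (by
`(n,m) ↦ (m+L, n+r)`) into the pairs `(m', n') ∈ [M₀+L, M₁) × [N₀+r, N₀+r+(N₁−N₀))` with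
`r_{μ₀,μ₂}(m'n') ∈ B` — the shape counted by `card_box_midDigit_mem_le` (`N₀ ≤ N₁`). [folklore] -/
theorem card_exc_le_box {k μ₀ μ₂ : ℕ} (B : Finset ℕ) {M₀ M₁ N₀ N₁ : ℕ} (hN : N₀ ≤ N₁) (L r : ℕ) :
    (((Ico N₀ N₁) ×ˢ ((Ico M₀ M₁).filter (fun m => m + L < M₁))).filter fun p : ℕ × ℕ =>
        midDigit k μ₀ μ₂ ((p.2 + L) * (p.1 + r)) ∈ B).card ≤
      (((Ico (M₀ + L) M₁) ×ˢ (Ico (N₀ + r) (N₀ + r + (N₁ - N₀)))).filter fun p : ℕ × ℕ =>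
        midDigit k μ₀ μ₂ (p.1 * p.2 + 0) ∈ B).card := by
  refine card_le_card_of_injOn (fun p => (p.2 + L, p.1 + r)) (fun p hp => ?_) (fun p hp p' hp' h => ?_)
  · rw [mem_coe, mem_filter, mem_product, mem_Ico, mem_filter, mem_Ico] at hp
    dsimp only
    rw [mem_coe, mem_filter, mem_product, mem_Ico, mem_Ico, add_zero]
    refine ⟨⟨⟨by omega, hp.1.2.2⟩, by omega, by omega⟩, hp.2⟩
  · simp only [Prod.mk.injEq] at h
    exact Prod.ext (by omega) (by omega)

end Count

end Literature.NumberTheory.LFunctions.MauduitRivat
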